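import Summits.BirchSwinnertonDyer.BirchSwinnertonDyer.Theorems.EisensteinDepletionAtTwoStarOptBNSFFormalSqrtPrelim
import HarnessLib

/-!
# The formal square root at `2`, II: the `2`-adic core (line `nsf`, crux `StarOptBNSF`, stmt-BirchSwinnertonDyer-27047)

**`isPadicInt_two_mul`**: over `ℚ₂`, for a `2`-integral Weierstrass equation `W`, a point `Q = (e, f) ∈ W(ℚ₂)` of
order `2` in the kernel of reduction (`‖e‖ > 1`), and any `B ∈ ℚ₂⟦z⟧` with `B(0) = 1`, `B² = X(z) − e z²`
(`X = formalXMulSq`): `2B ∈ ℤ₂⟦z⟧`.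

Proof (elementary `2`-adic analysis; no isogeny, no Néron model).  Put `z_Q = −e/f`, `N := 4X − 4e z² = 4B²`.
By file I, `N(z_Q) = N′(z_Q) = 0`; hence in `N = (z − z_Q)²·U` (`U := N·(1/(z_Q − z))²`) the series `U` is
`2`-INTEGRAL: `z_Q^{n+2}U_n = Σ_{j≤n} (n+1−j)N_j z_Q^j` is minus the tail of the series `Σ_j (n+1−j)N_j z_Q^j = 0`,
of norm `≤ ‖z_Q‖^{n+2}`.  Comparing coefficients of `N = U(z_Q − z)²` gives `U_n ≡ 0 (mod 4)` for `n ≥ 1` and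
`U_0 = (2/z_Q)²`; so `V := 2B/(z_Q − z)` has `V² = U`, `V(0) = 2/z_Q` a unit, and by induction on
`2V(0)V_n = U_n − Σ_{0<i<n} V_iV_{n−i}` all `‖V_n‖ ≤ ½`; finally `2B = V·(z_Q − z)`.  For a NON-formal
`2`-torsion abscissa the same `B` has unbounded `2`-power denominators (census HOME/p1g10, 279 curves), so the
hypothesis is sharp.  BSD is not proved by this file; nothing here reads `r_an`.
-/

set_option linter.dupNamespace false
set_option autoImplicit false

noncomputable section

open PowerSeries
open Literature.NumberTheory.EllipticCurves
open Summit.BirchSwinnertonDyer.BirchSwinnertonDyer.Rank2Observatory (padic_norm_two)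

namespace Summit.BirchSwinnertonDyer.BirchSwinnertonDyer.Theorems.DepletionAtTwo.FormalSqrt

section Core

variable (W : WeierstrassCurve ℚ_[2]) [hW : W.IsIntegral ℤ_[2]]
variable {W}
variable {e f : ℚ_[2]} (heq : W.toAffine.Equation e f) (htor : 2 * f + W.a₁ * e + W.a₃ = 0)
  (he : 1 < ‖e‖)

include heq htor he in
/-- **The core.**  For `B ∈ ℚ₂⟦z⟧` with `B(0) = 1` and `B² = X(z) − x₁z²`, `2B ∈ ℤ₂⟦z⟧`.
[Silverman AEC IV.1 (formal group), VII.2.2 (dictionary)] [folklore] -/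
theorem isPadicInt_two_mul (B : ℚ_[2]⟦X⟧) (hB0 : constantCoeff B = 1)
    (hB : B ^ 2 = W.formalXMulSq - C e * X ^ 2) : IsPadicInt (C (2 : ℚ_[2]) * B) := by
  have norm_four_eq : ‖(4 : ℚ_[2])‖ = 4⁻¹ := by
    rw [show (4 : ℚ_[2]) = 2 * 2 by norm_num, norm_mul, padic_norm_two]; norm_num
  obtain ⟨hf0, hz0, hz1, ht1, hzn⟩ := param_norms heq htor he
  have he4 := norm_e_le_four heq htor he
  set z : ℚ_[2] := -e / f with hz
  set t : ℚ_[2] := 2 / z with htdef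
  -- the integral series `N = 4X − 4x₁z² = 4B²`
  set 𝒳 := W.formalXMulSq with h𝒳
  set N : ℚ_[2]⟦X⟧ := C (4 : ℚ_[2]) * 𝒳 - C (4 * e) * X ^ 2 with hN
  have hX : IsPadicInt 𝒳 := W.isPadicInt_formalXMulSq
  have hXv : IsPadicInt (PowerSeries.X : ℚ_[2]⟦X⟧) := IsPadicInt.powerSeries_X
  have h4 : IsPadicInt (C (4 : ℚ_[2]) : ℚ_[2]⟦X⟧) :=
    IsPadicInt.powerSeries_C (by rw [norm_four_eq]; norm_num)
  have h4e : IsPadicInt (C (4 * e) : ℚ_[2]⟦X⟧) := IsPadicInt.powerSeries_C (by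
    rw [norm_mul, norm_four_eq]
    calc 4⁻¹ * ‖e‖ ≤ 4⁻¹ * 4 := by gcongr
      _ = 1 := by norm_num)
  have hNi : IsPadicInt N := (h4.mul hX).sub (h4e.mul (hXv.pow 2))
  have hNB : N = C (4 : ℚ_[2]) * B ^ 2 := by
    rw [hN, hB, map_mul]; ring
  -- `N(z) = 0`, `N′(z) = 0`
  have hXz : padicEval 𝒳 z = e * z ^ 2 := W.padicEval_formalXMulSq_eq heq he
  have hNz : padicEval N z = 0 := by
    rw [hN, padicEval_sub (h4.mul hX) (h4e.mul (hXv.pow 2)) hz1, padicEval_mul h4 hX hz1,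
      padicEval_C, hXz, padicEval_mul h4e (hXv.pow 2) hz1, padicEval_C, padicEval_pow hXv hz1,
      padicEval_X]
    ring
  have hN'i : IsPadicInt (d⁄dX ℚ_[2] N) := isPadicInt_derivative hNi
  have hX'i : IsPadicInt (d⁄dX ℚ_[2] 𝒳) := isPadicInt_derivative hX
  have h8e : IsPadicInt (C (4 * e * 2) : ℚ_[2]⟦X⟧) := by
    rw [map_mul]
    exact h4e.mul (IsPadicInt.powerSeries_C (by rw [padic_norm_two]; norm_num))
  have hN'z : padicEval (d⁄dX ℚ_[2] N) z = 0 := by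
    have hder : d⁄dX ℚ_[2] N = C (4 : ℚ_[2]) * d⁄dX ℚ_[2] 𝒳 - C (4 * e * 2) * X := by
      rw [hN, map_sub]
      have h1 : d⁄dX ℚ_[2] (C (4 : ℚ_[2]) * 𝒳) = C (4 : ℚ_[2]) * d⁄dX ℚ_[2] 𝒳 := by
        rw [(d⁄dX ℚ_[2]).leibniz, derivative_C, smul_zero, add_zero, smul_eq_mul]
      have h2 : d⁄dX ℚ_[2] (C (4 * e) * X ^ 2 : ℚ_[2]⟦X⟧) = C (4 * e * 2) * X := by
        rw [(d⁄dX ℚ_[2]).leibniz, derivative_C, smul_zero, add_zero,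
          (d⁄dX ℚ_[2]).leibniz_pow, derivative_X]
        simp only [map_mul, map_ofNat, smul_eq_mul, nsmul_eq_mul, mul_one, Nat.cast_ofNat]
        ring
      rw [h1, h2]
    rw [hder, padicEval_sub (h4.mul hX'i) (h8e.mul hXv) hz1, padicEval_mul h4 hX'i hz1, padicEval_C,
      padicEval_derivative_formalXMulSq heq htor he, padicEval_mul h8e hXv hz1, padicEval_C,
      padicEval_X]
    ring
  -- the two vanishing sums
  have hS₀ : HasSum (fun j ↦ coeff j N * z ^ j) 0 := hNz ▸ hasSum_padicEval hNi hz1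
  have hS₁ : HasSum (fun j : ℕ ↦ (j : ℚ_[2]) * coeff j N * z ^ j) 0 := by
    have h1 : HasSum (fun j ↦ coeff j (d⁄dX ℚ_[2] N) * z ^ j) 0 := hN'z ▸ hasSum_padicEval hN'i hz1
    have h2 : HasSum (fun j ↦ z * (coeff j (d⁄dX ℚ_[2] N) * z ^ j)) (z * 0) := h1.mul_left z
    have h3 : HasSum (fun j : ℕ ↦ ((j + 1 : ℕ) : ℚ_[2]) * coeff (j + 1) N * z ^ (j + 1)) 0 := by
      rw [mul_zero] at h2
      convert h2 using 1
      funext j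
      rw [coeff_derivative]; push_cast; ring
    have h4' := (hasSum_nat_add_iff' (f := fun j : ℕ ↦ (j : ℚ_[2]) * coeff j N * z ^ j) 1 (g := 0)).mp
    simp only [Finset.range_one, Finset.sum_singleton, Nat.cast_zero, zero_mul, sub_zero] at h4'
    exact h4' h3
  -- `U := N · (1/(z_Q − z))²`, `N = U·(z_Q − z)²`
  set u : ℚ_[2]ˣ := Units.mk0 z hz0 with hu
  have huz : (u : ℚ_[2]) = z := Units.val_mk0 _
  set D : ℚ_[2]⟦X⟧ := invUnitsSub u ^ 2 with hD
  set U : ℚ_[2]⟦X⟧ := N * D with hU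
  have hNU : N = U * (C z - X) ^ 2 := by
    rw [hU, mul_assoc, hD, ← huz, mul_comm (invUnitsSub u ^ 2), sub_sq_mul_invUnitsSub_sq, mul_one]
  -- `U ∈ ℤ₂⟦z⟧`
  have hUn : ∀ n, ‖coeff n U‖ ≤ 1 := by
    intro n
    have hzpow : z ^ (n + 2) * coeff n U =
        ∑ j ∈ Finset.range (n + 1), ((n : ℚ_[2]) + 1 - j) * coeff j N * z ^ j := by
      rw [hU, coeff_mul, Finset.Nat.sum_antidiagonal_eq_sum_range_succ
        (fun i j ↦ coeff i N * coeff j D), Finset.mul_sum]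
      refine Finset.sum_congr rfl fun j hj ↦ ?_
      have hjn : j ≤ n := Nat.lt_succ_iff.mp (Finset.mem_range.mp hj)
      rw [hD, coeff_invUnitsSub_sq, huz]
      have hzne : z ^ (n - j + 2) ≠ 0 := pow_ne_zero _ hz0
      rw [show z ^ (n + 2) = z ^ j * z ^ (n - j + 2) by rw [← pow_add]; congr 1; omega]
      field_simp
      push_cast [Nat.cast_sub hjn]
      ring
    -- the finite sum is minus the tail of a series summing to `0`
    set g : ℕ → ℚ_[2] := fun j ↦ ((n : ℚ_[2]) + 1 - j) * coeff j N * z ^ j with hg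
    have hgsum : HasSum g 0 := by
      have := (hS₀.mul_left ((n : ℚ_[2]) + 1)).sub hS₁
      simp only [mul_zero, sub_zero] at this
      have hfun : g = fun b ↦ ((n : ℚ_[2]) + 1) * (coeff b N * z ^ b) - (b : ℚ_[2]) * coeff b N * z ^ b := by
        funext j; simp only [hg]; ring
      rw [hfun]; exact this
    have htail := (hasSum_nat_add_iff' (f := g) (n + 1)).mpr hgsum
    have hfin : ∑ j ∈ Finset.range (n + 1), g j = -∑' i, g (i + (n + 1)) := by
      rw [htail.tsum_eq]; ring
    have htailnorm : ‖∑' i, g (i + (n + 1))‖ ≤ ‖z‖ ^ (n + 2) := by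
      refine IsUltrametricDist.norm_tsum_le_of_forall_le_of_nonneg (by positivity) fun i ↦ ?_
      rcases i with _ | i
      · simp [hg]
      · simp only [hg]
        rw [norm_mul, norm_mul, norm_pow]
        have hc : ‖((n : ℚ_[2]) + 1 - ((i + 1 + (n + 1) : ℕ) : ℚ_[2]))‖ ≤ 1 := by
          rw [show ((n : ℚ_[2]) + 1 - ((i + 1 + (n + 1) : ℕ) : ℚ_[2])) = -((i + 1 : ℕ) : ℚ_[2]) by
            push_cast; ring, norm_neg]
          exact norm_natCast_le_one' _
        have hN1 := isPadicInt_iff_coeff.mp hNi (i + 1 + (n + 1))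
        calc ‖(n : ℚ_[2]) + 1 - ((i + 1 + (n + 1) : ℕ) : ℚ_[2])‖ * ‖coeff (i + 1 + (n + 1)) N‖ *
              ‖z‖ ^ (i + 1 + (n + 1))
            ≤ 1 * 1 * ‖z‖ ^ (i + 1 + (n + 1)) := by gcongr
          _ = ‖z‖ ^ (n + 2) * ‖z‖ ^ i := by rw [← pow_add]; ring_nf
          _ ≤ ‖z‖ ^ (n + 2) * 1 := by gcongr; exact pow_le_one₀ (norm_nonneg _) hz1.le
          _ = ‖z‖ ^ (n + 2) := mul_one _
    have hbound : ‖z ^ (n + 2) * coeff n U‖ ≤ ‖z‖ ^ (n + 2) := by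
      rw [hzpow, show (∑ j ∈ Finset.range (n + 1), ((n : ℚ_[2]) + 1 - j) * coeff j N * z ^ j) =
        ∑ j ∈ Finset.range (n + 1), g j from rfl, hfin, norm_neg]
      exact htailnorm
    rw [norm_mul, norm_pow] at hbound
    have hzp : 0 < ‖z‖ ^ (n + 2) := pow_pos (norm_pos_iff.mpr hz0) _
    exact le_of_mul_le_mul_left (by linarith [hbound]) hzp
  have hUi : IsPadicInt U := isPadicInt_iff_coeff.mpr hUn
  -- `U ≡ U(0) (mod 4)` and `U(0) = t²`
  have hU0 : coeff 0 U = t ^ 2 := by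
    have h0 : coeff 0 N = 4 := by
      rw [hN, map_sub, coeff_C_mul, coeff_C_mul, coeff_zero_eq_constantCoeff, h𝒳,
        WeierstrassCurve.constantCoeff_formalXMulSq]
      simp
    have hmul0 : coeff 0 U = coeff 0 N * coeff 0 D := by
      simp only [hU, coeff_zero_eq_constantCoeff, map_mul]
    rw [hmul0, h0, hD, coeff_invUnitsSub_sq, huz, htdef]
    field_simp
    ring
  have hUq : ∀ n, 1 ≤ n → ‖coeff n U‖ ≤ 4⁻¹ := by
    intro n hn
    have hrec : coeff (n + 2) N = z ^ 2 * coeff (n + 2) U - 2 * z * coeff (n + 1) U + coeff n U := by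
      rw [hNU]; exact coeff_mul_sub_sq U z n
    have hNn : coeff (n + 2) N = 4 * coeff (n + 2) 𝒳 := by
      rw [hN, map_sub, coeff_C_mul, coeff_C_mul, coeff_X_pow, if_neg (by omega)]
      ring
    have hsolve : coeff n U = 4 * coeff (n + 2) 𝒳 - z ^ 2 * coeff (n + 2) U + 2 * z * coeff (n + 1) U := by
      linear_combination hNn - hrec
    rw [hsolve]
    have hA : ‖4 * coeff (n + 2) 𝒳‖ ≤ 4⁻¹ := by
      rw [norm_mul, norm_four_eq]
      exact mul_le_of_le_one_right (by norm_num) (isPadicInt_iff_coeff.mp hX _)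
    have hBn : ‖z ^ 2 * coeff (n + 2) U‖ ≤ 4⁻¹ := by
      rw [norm_mul, norm_pow, hzn]
      calc (2⁻¹ : ℝ) ^ 2 * ‖coeff (n + 2) U‖ ≤ (2⁻¹ : ℝ) ^ 2 * 1 := by gcongr; exact hUn _
        _ = 4⁻¹ := by norm_num
    have hCn : ‖2 * z * coeff (n + 1) U‖ ≤ 4⁻¹ := by
      rw [norm_mul, norm_mul, padic_norm_two, hzn]
      calc (2⁻¹ : ℝ) * 2⁻¹ * ‖coeff (n + 1) U‖ ≤ 2⁻¹ * 2⁻¹ * 1 := by gcongr; exact hUn _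
        _ = 4⁻¹ := by norm_num
    refine (IsUltrametricDist.norm_add_le_max _ _).trans (max_le ?_ hCn)
    exact (norm_sub_le_max' _ _).trans (max_le hA hBn)
  -- `V := 2B/(z_Q − z)`, `V² = U`, `V(0) = t`
  set V : ℚ_[2]⟦X⟧ := C (2 : ℚ_[2]) * B * invUnitsSub u with hV
  have hV2 : V ^ 2 = U := by
    rw [hV, mul_pow, mul_pow, ← hD, hU, hNB, ← map_pow]
    norm_num
  have hV0 : coeff 0 V = t := by
    have hc : coeff 0 V = constantCoeff (C (2 : ℚ_[2]) : ℚ_[2]⟦X⟧) * constantCoeff B *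
        coeff 0 (invUnitsSub u) := by
      simp only [hV, coeff_zero_eq_constantCoeff, map_mul]
    rw [hc, hB0, constantCoeff_C, coeff_invUnitsSub, divp_eq_div, zero_add, pow_one, huz, htdef]
    ring
  have ht2 : ‖2 * t‖ = 2⁻¹ := by rw [norm_mul, padic_norm_two, ht1, mul_one]
  -- induction: `‖V_n‖ ≤ ½` for `n ≥ 1`
  have hVn : ∀ n, 1 ≤ n → ‖coeff n V‖ ≤ 2⁻¹ := by
    intro n
    induction n using Nat.strong_induction_on with
    | _ n ih =>
      intro hn
      have hsq := coeff_sq_eq V hn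
      rw [hV2, hV0] at hsq
      have hsum : ‖∑ i ∈ Finset.Ioo 0 n, coeff i V * coeff (n - i) V‖ ≤ 4⁻¹ := by
        refine IsUltrametricDist.norm_sum_le_of_forall_le_of_nonneg (by norm_num) fun i hi ↦ ?_
        obtain ⟨hi0, hin⟩ := Finset.mem_Ioo.mp hi
        rw [norm_mul]
        calc ‖coeff i V‖ * ‖coeff (n - i) V‖ ≤ 2⁻¹ * 2⁻¹ := by
              gcongr
              · exact ih i hin (by omega)
              · exact ih (n - i) (by omega) (by omega)
          _ = 4⁻¹ := by norm_num
      have h2tV : 2 * t * coeff n V = coeff n U - ∑ i ∈ Finset.Ioo 0 n, coeff i V * coeff (n - i) V := by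
        linear_combination -hsq
      have hnorm : ‖2 * t * coeff n V‖ ≤ 4⁻¹ := by
        rw [h2tV]
        exact (norm_sub_le_max' _ _).trans (max_le (hUq n hn) hsum)
      rw [norm_mul, ht2] at hnorm
      linarith
  have hVi : IsPadicInt V := by
    rw [isPadicInt_iff_coeff]
    intro n
    rcases n with _ | n
    · rw [hV0]; exact ht1.le
    · exact (hVn (n + 1) (by omega)).trans (by norm_num)
  -- `2B = V · (z_Q − z)`
  have h2B : C (2 : ℚ_[2]) * B = V * (C z - X) := by
    rw [hV, mul_assoc (C (2 : ℚ_[2]) * B), ← huz, invUnitsSub_mul_sub, mul_one]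
  rw [h2B]
  exact hVi.mul ((IsPadicInt.powerSeries_C (hzn ▸ by norm_num)).sub hXv)

end Core

end Summit.BirchSwinnertonDyer.BirchSwinnertonDyer.Theorems.DepletionAtTwo.FormalSqrt

end
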